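import Summits.CriticalPhenomena.Ising3DConformalLimit.Theses.EnergyNotSigmaSquared
import Summits.CriticalPhenomena.Ising3DConformalLimit.Theorems.GapForcesFarMerging.Negative.SoftShapes
import Summits.CriticalPhenomena.Ising3DConformalLimit.Theorems.EnergyNotSigmaSquaredGapForcesFarMergingRpUnpinch
import Summits.CriticalPhenomena.Ising3DConformalLimit.Theorems.EnergyNotSigmaSquaredGapForcesFarMergingUnpinchedEnvelope
import Summits.CriticalPhenomena.Ising3DConformalLimit.Theorems.EnergyNotSigmaSquaredGapForcesFarMergingSinglePinchPositive
import Summits.CriticalPhenomena.Ising3DConformalLimit.Theorems.EnergyNotSigmaSquaredGapForcesFarMergingScaleIteration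
import Literature.Probability.LatticeModels.CriticalUrsellFourSign
import Literature.Probability.LatticeModels.CriticalTwoPointBounds

/-!
# Line `rp-unpinch-single-passage` — LEAD skeleton for crux `GapForcesFarMerging`
# (item stmt-CriticalPhenomena-4468, route `EnergyNotSigmaSquared`, rank 2; lead generation 1)

Crux: `GapForcesFarMerging := EnergyGapPowerLaw → FarMerging` (GAP: the truncated critical
energy–energy correlation `⟨σ₀σ_{e₂} ; σ_xσ_{x+e₂}⟩` on `ℤ³` is `≤ C‖x‖^{-κ}⟨σ₀σ_x⟩²`, `κ > 0`;
FarMerging: `U₄(Lx) ≤ -c⟨σσ⟩⟨σσ⟩` along infinitely many dilations of one injective shape,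
`= Negative.FarMergingShape Negative.cc2 (criticalCorr 3 4)` by `Negative.SoftShapes.crux_iff`, `Iff.rfl`).

Lead reshaping (prover-line-stmt-CriticalPhenomena-4468-0, 2026-08-16) of the planner's checked
skeleton (generation 2, `Lines/rp-unpinch-single-passage.lean`, five stubs): the five stub
STATEMENTS are mathematically unchanged but are now written out over tree vocabulary only
(`criticalCorr 3 4`, `criticalCorr 3 2`, `criticalTwoPoint 3`, `Pi.single`, and the landed
`Negative.e₂ / Negative.cc2 / Negative.FarMergingShape`), with NO `def … : Prop` in this file, so that
(i) every stub can be landed verbatim as a `--supports` helper file under `Theorems/` without a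
reviewed `…Defs` module (closed propositions under `Summits/` are reserved for registered obligations),
and (ii) the registered signatures are literally the statements the workers prove.
Dictionary with the planner's vocabulary: `xR m = Pi.single 0 (2m)`, `up m = xR m + Pi.single 1 m`,
`dn m = xR m - Pi.single 1 m`, `mirror m y = y - Pi.single 0 (2 (y 0 - m))`, `src s = Pi.single 1 s`,
`pairCov a b c d = criticalCorr 3 4 ![a,b,c,d] - criticalCorr 3 2 ![a,b] * criticalCorr 3 2 ![c,d]`,
`T b m = pairCov 0 b (up m) (dn m)`, `Npar b m = cc2 0 (dn m) * cc2 b (up m)`, `𝒜 b m = T b m / Npar b m`.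

## The line (idea card `Ideas/rp-unpinch-single-passage.md`, line card `Lines/rp-unpinch-single-passage.md`)

1. `stub_rpUnpinch` (M): reflection positivity of the critical state through the SITE plane
   `{x₀ = m}` (free symmetric boxes are RP, `isingExpect_free_reflect_mul_self_nonneg`; box limits
   `criticalCorr_wellDefined_holds`; translation `criticalCorr_translate`, hyperoctahedral symmetry
   `criticalCorr_signedPerm`, relabelling `criticalCorr_comp_perm`) gives the `2 × 2` Gram minor
   `⟨ε_b ; σ_yσ_z⟩² ≤ ⟨ε_b ; ε_{θb}⟩ · ⟨σ_{θy}σ_{θz} ; σ_yσ_z⟩` for all far-side targets `y, z`.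
2. `stub_unpinchedEnvelope` (S): `0 ≤ ⟨σ_{me₂}σ_{-me₂} ; σ_{up m}σ_{dn m}⟩ ≤ 2⟨σ₀σ_{2me₁}⟩²`
   (GKS II `criticalCorr_griffiths`; Lebowitz `criticalUrsellFour_nonpos`; coordinate MMS
   `messager_miracleSole_holds`; reflections `twoPointPlus_reflection_invariant_holds`).
   1 + 2 + GAP ⟹ the single-pinch law with exponent `κ/2` (`gapGivesSinglePinch`, PROVED below).
3. `stub_singlePinchPositive` (M–L): `0 < ⟨σ₀σ_{e₂} ; σ_{up m}σ_{dn m}⟩` for every `m ≥ 1`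
   (switching lemma in the box: the truncation is `⟨σ₀σ_{e₂}σ_{up}σ_{dn}⟩_Λ · P^{0e₂ up dn,∅}_Λ[up ↮ dn]`,
   and a finite-energy surgery bounds the probability below uniformly in `Λ`; then the box limit).
4. `stub_quasiMultiplicative` (XL, HARDEST, held by the lead): one-passage quasi-multiplicativity
   `c · 𝒜(e₂; s) · 𝒜(s e₂; m) ≤ 𝒜(e₂; m)` for `1 ≤ s ≤ m/2` — the crux's genuine content
   (separation + source-Harnack for ONE passage from adjacent nails; Disproof §7:
   `quasiMultiplicative_false_without_model` — the model must enter here).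
5. `stub_scaleIteration` (M, soft): single-pinch law ∧ positivity ∧ quasi-multiplicativity ⟹ far
   merging along a thin shape `Th(2^ℓ) = (0,(2^{ℓ+1},-2^ℓ,0),e₂,(2^{ℓ+1},2^ℓ,0))` — PROVED over the
   soft package by the standing disprover (`Disproof.lean` §7 `scaleIteration_soft`, instantiated by
   `softPackageNoBubble_criticalCorr`); the worker lands that proof as a helper file.

`GapForcesFarMerging_of` composes 1–5 into the crux BY NAME (pure logic + `gapGivesSinglePinch`).

Disproof used (tree `Cruxes/GapForcesFarMerging/Disproof.lean` v11, read 2026-08-16T00:45Z):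
`crux_iff` (shape), `quasiMultiplicative_false_without_model` / `lineInputs_without_QM_and_farMerging`
(family A′: stubs 1–3, 5 hold softly together with GAP and ¬FarMerging — stub 4 is where the model
enters), `scaleIteration_criticalCorr` (stub 5 holds), `gapForcesFarMerging_of_four_stubs`
(the crux follows from stubs 1–4), §7 docblock "stubs 1, 2, 3 are ISING-TRUE".
-/

noncomputable section

namespace Summit.CriticalPhenomena.Ising3DConformalLimit.Cruxes.GapForcesFarMerging.RpUnpinchSinglePassage

open Literature.Probability.LatticeModels
open Summit.CriticalPhenomena.Ising3DConformalLimit.Theses.EnergyNotSigmaSquared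
open Summit.CriticalPhenomena.Ising3DConformalLimit.Theorems.GapForcesFarMerging.Negative
  (e₁ e₂ cc2 FarMergingShape crux_iff)

/-! ## Registered stubs (statements over tree vocabulary only) -/

/-- **Stub 1 (M) — RP un-pinching.** The `2×2` Gram minor (energy row × pair row) of reflection
positivity of the critical state through the site plane `{x₀ = m}`: for all targets `y, z` with
`y₀, z₀ ≥ m`, `⟨σ₀σ_{e₂} ; σ_yσ_z⟩² ≤ ⟨σ₀σ_{e₂} ; σ_{2me₁}σ_{2me₁+e₂}⟩ · ⟨σ_{θy}σ_{θz} ; σ_yσ_z⟩`,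
`θ : x₀ ↦ 2m - x₀`. [cite: FILS1978, Thm. 2.1] -/
theorem stub_rpUnpinch :
    ∀ (m : ℕ) (y z : Site 3), (m : ℤ) ≤ y 0 → (m : ℤ) ≤ z 0 →
      (criticalCorr 3 4 ![0, e₂, y, z] - criticalCorr 3 2 ![0, e₂] * criticalCorr 3 2 ![y, z]) ^ 2 ≤
        (criticalCorr 3 4 ![0, e₂, Pi.single 0 (2 * (m : ℤ)), Pi.single 0 (2 * (m : ℤ)) + e₂] - criticalCorr 3 2 ![0, e₂] * criticalCorr 3 2 ![Pi.single 0 (2 * (m : ℤ)), Pi.single 0 (2 * (m : ℤ)) + e₂]) *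
          (criticalCorr 3 4 ![y - Pi.single 0 (2 * (y 0 - m)), z - Pi.single 0 (2 * (z 0 - m)), y, z] - criticalCorr 3 2 ![y - Pi.single 0 (2 * (y 0 - m)), z - Pi.single 0 (2 * (z 0 - m))] * criticalCorr 3 2 ![y, z]) :=
  _root_.Summit.CriticalPhenomena.Ising3DConformalLimit.EnergyNotSigmaSquaredGapForcesFarMerging.stub_rpUnpinch

/-- **Stub 2 (S) — the un-pinched envelope.** `0 ≤ ⟨σ_{me₂}σ_{-me₂} ; σ_{up m}σ_{dn m}⟩ ≤ 2⟨σ₀σ_{2me₁}⟩²`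
for `m ≥ 1` (GKS II; Lebowitz + Messager–Miracle-Solé).
[cite: Lebowitz1974, Theorem, eq. (2.5b)] [cite: MessagerMiracleSoleJSP1977, main theorem] -/
theorem stub_unpinchedEnvelope :
    ∀ m : ℕ, 1 ≤ m →
      0 ≤ criticalCorr 3 4 ![Pi.single 1 (m : ℤ), Pi.single 1 (-(m : ℤ)), Pi.single 0 (2 * (m : ℤ)) + Pi.single 1 (m : ℤ), Pi.single 0 (2 * (m : ℤ)) - Pi.single 1 (m : ℤ)] - criticalCorr 3 2 ![Pi.single 1 (m : ℤ), Pi.single 1 (-(m : ℤ))] * criticalCorr 3 2 ![Pi.single 0 (2 * (m : ℤ)) + Pi.single 1 (m : ℤ), Pi.single 0 (2 * (m : ℤ)) - Pi.single 1 (m : ℤ)] ∧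
        criticalCorr 3 4 ![Pi.single 1 (m : ℤ), Pi.single 1 (-(m : ℤ)), Pi.single 0 (2 * (m : ℤ)) + Pi.single 1 (m : ℤ), Pi.single 0 (2 * (m : ℤ)) - Pi.single 1 (m : ℤ)] - criticalCorr 3 2 ![Pi.single 1 (m : ℤ), Pi.single 1 (-(m : ℤ))] * criticalCorr 3 2 ![Pi.single 0 (2 * (m : ℤ)) + Pi.single 1 (m : ℤ), Pi.single 0 (2 * (m : ℤ)) - Pi.single 1 (m : ℤ)] ≤
          2 * criticalTwoPoint 3 (Pi.single 0 (2 * (m : ℤ))) ^ 2 :=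
  _root_.Summit.CriticalPhenomena.Ising3DConformalLimit.EnergyNotSigmaSquaredGapForcesFarMerging.stub_unpinchedEnvelope

/-- **Stub 3 (M–L) — strict positivity of the single-pinch truncation** at every scale:
`0 < ⟨σ₀σ_{e₂} ; σ_{up m}σ_{dn m}⟩_{β_c}` for `m ≥ 1` (switching lemma + finite energy in the box,
then the box limit `criticalCorr_wellDefined_holds`). [folklore] -/
theorem stub_singlePinchPositive :
    ∀ m : ℕ, 1 ≤ m →
      0 < criticalCorr 3 4 ![0, e₂, Pi.single 0 (2 * (m : ℤ)) + Pi.single 1 (m : ℤ), Pi.single 0 (2 * (m : ℤ)) - Pi.single 1 (m : ℤ)] - criticalCorr 3 2 ![0, e₂] * criticalCorr 3 2 ![Pi.single 0 (2 * (m : ℤ)) + Pi.single 1 (m : ℤ), Pi.single 0 (2 * (m : ℤ)) - Pi.single 1 (m : ℤ)] :=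
  _root_.Summit.CriticalPhenomena.Ising3DConformalLimit.EnergyNotSigmaSquaredGapForcesFarMerging.stub_singlePinchPositive

/-- **Stub 4 (XL, HARDEST, the lead's) — one-passage quasi-multiplicativity** of the normalised
single-pinch avoidance functional `𝒜(b; m) = ⟨σ₀σ_b ; σ_{up m}σ_{dn m}⟩ / (⟨σ₀σ_{dn m}⟩⟨σ_bσ_{up m}⟩)`:
a UNIFORM `c > 0` with `c · 𝒜(e₂; s) · 𝒜(s e₂; m) ≤ 𝒜(e₂; m)` for `1 ≤ s ≤ m/2`.
[cite: Lawler1991, ch. 3–5] [cite: arXiv:math/0508344] [cite: doi:10.1214/16-AOP1165] -/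
theorem stub_quasiMultiplicative :
    ∃ c : ℝ, 0 < c ∧ ∀ s m : ℕ, 1 ≤ s → 2 * s ≤ m →
      c * ((criticalCorr 3 4 ![0, e₂, Pi.single 0 (2 * (s : ℤ)) + Pi.single 1 (s : ℤ), Pi.single 0 (2 * (s : ℤ)) - Pi.single 1 (s : ℤ)] - criticalCorr 3 2 ![0, e₂] * criticalCorr 3 2 ![Pi.single 0 (2 * (s : ℤ)) + Pi.single 1 (s : ℤ), Pi.single 0 (2 * (s : ℤ)) - Pi.single 1 (s : ℤ)]) / (criticalCorr 3 2 ![0, Pi.single 0 (2 * (s : ℤ)) - Pi.single 1 (s : ℤ)] * criticalCorr 3 2 ![e₂, Pi.single 0 (2 * (s : ℤ)) + Pi.single 1 (s : ℤ)])) *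
          ((criticalCorr 3 4 ![0, Pi.single 1 (s : ℤ), Pi.single 0 (2 * (m : ℤ)) + Pi.single 1 (m : ℤ), Pi.single 0 (2 * (m : ℤ)) - Pi.single 1 (m : ℤ)] - criticalCorr 3 2 ![0, Pi.single 1 (s : ℤ)] * criticalCorr 3 2 ![Pi.single 0 (2 * (m : ℤ)) + Pi.single 1 (m : ℤ), Pi.single 0 (2 * (m : ℤ)) - Pi.single 1 (m : ℤ)]) / (criticalCorr 3 2 ![0, Pi.single 0 (2 * (m : ℤ)) - Pi.single 1 (m : ℤ)] * criticalCorr 3 2 ![Pi.single 1 (s : ℤ), Pi.single 0 (2 * (m : ℤ)) + Pi.single 1 (m : ℤ)])) ≤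
        (criticalCorr 3 4 ![0, e₂, Pi.single 0 (2 * (m : ℤ)) + Pi.single 1 (m : ℤ), Pi.single 0 (2 * (m : ℤ)) - Pi.single 1 (m : ℤ)] - criticalCorr 3 2 ![0, e₂] * criticalCorr 3 2 ![Pi.single 0 (2 * (m : ℤ)) + Pi.single 1 (m : ℤ), Pi.single 0 (2 * (m : ℤ)) - Pi.single 1 (m : ℤ)]) / (criticalCorr 3 2 ![0, Pi.single 0 (2 * (m : ℤ)) - Pi.single 1 (m : ℤ)] * criticalCorr 3 2 ![e₂, Pi.single 0 (2 * (m : ℤ)) + Pi.single 1 (m : ℤ)]) := by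
  sorry

/-- **Stub 5 (M, soft) — thin-shape scale iteration.** Single-pinch law (exponent `κ' > 0`) ∧
strict single-pinch positivity ∧ one-passage quasi-multiplicativity ⟹ far merging (along
`Th(2^ℓ)`, by contradiction with `c = 1/2`, with abundance of doubling scales from
`c‖x‖⁻² ≤ ⟨σ₀σ_x⟩ ≤ 1`); proved over the soft package in `Disproof.lean` §7 (`scaleIteration_soft`). [folklore] -/
theorem stub_scaleIteration :
    (∃ κ' C : ℝ, 0 < κ' ∧ ∀ m : ℕ, 1 ≤ m →
        criticalCorr 3 4 ![0, e₂, Pi.single 0 (2 * (m : ℤ)) + Pi.single 1 (m : ℤ), Pi.single 0 (2 * (m : ℤ)) - Pi.single 1 (m : ℤ)] - criticalCorr 3 2 ![0, e₂] * criticalCorr 3 2 ![Pi.single 0 (2 * (m : ℤ)) + Pi.single 1 (m : ℤ), Pi.single 0 (2 * (m : ℤ)) - Pi.single 1 (m : ℤ)] ≤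
          C * (2 * (m : ℝ)) ^ (-κ') * criticalTwoPoint 3 (Pi.single 0 (2 * (m : ℤ))) ^ 2) →
      (∀ m : ℕ, 1 ≤ m →
        0 < criticalCorr 3 4 ![0, e₂, Pi.single 0 (2 * (m : ℤ)) + Pi.single 1 (m : ℤ), Pi.single 0 (2 * (m : ℤ)) - Pi.single 1 (m : ℤ)] - criticalCorr 3 2 ![0, e₂] * criticalCorr 3 2 ![Pi.single 0 (2 * (m : ℤ)) + Pi.single 1 (m : ℤ), Pi.single 0 (2 * (m : ℤ)) - Pi.single 1 (m : ℤ)]) →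
      (∃ c : ℝ, 0 < c ∧ ∀ s m : ℕ, 1 ≤ s → 2 * s ≤ m →
        c * ((criticalCorr 3 4 ![0, e₂, Pi.single 0 (2 * (s : ℤ)) + Pi.single 1 (s : ℤ), Pi.single 0 (2 * (s : ℤ)) - Pi.single 1 (s : ℤ)] - criticalCorr 3 2 ![0, e₂] * criticalCorr 3 2 ![Pi.single 0 (2 * (s : ℤ)) + Pi.single 1 (s : ℤ), Pi.single 0 (2 * (s : ℤ)) - Pi.single 1 (s : ℤ)]) / (criticalCorr 3 2 ![0, Pi.single 0 (2 * (s : ℤ)) - Pi.single 1 (s : ℤ)] * criticalCorr 3 2 ![e₂, Pi.single 0 (2 * (s : ℤ)) + Pi.single 1 (s : ℤ)])) *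
            ((criticalCorr 3 4 ![0, Pi.single 1 (s : ℤ), Pi.single 0 (2 * (m : ℤ)) + Pi.single 1 (m : ℤ), Pi.single 0 (2 * (m : ℤ)) - Pi.single 1 (m : ℤ)] - criticalCorr 3 2 ![0, Pi.single 1 (s : ℤ)] * criticalCorr 3 2 ![Pi.single 0 (2 * (m : ℤ)) + Pi.single 1 (m : ℤ), Pi.single 0 (2 * (m : ℤ)) - Pi.single 1 (m : ℤ)]) / (criticalCorr 3 2 ![0, Pi.single 0 (2 * (m : ℤ)) - Pi.single 1 (m : ℤ)] * criticalCorr 3 2 ![Pi.single 1 (s : ℤ), Pi.single 0 (2 * (m : ℤ)) + Pi.single 1 (m : ℤ)])) ≤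
          (criticalCorr 3 4 ![0, e₂, Pi.single 0 (2 * (m : ℤ)) + Pi.single 1 (m : ℤ), Pi.single 0 (2 * (m : ℤ)) - Pi.single 1 (m : ℤ)] - criticalCorr 3 2 ![0, e₂] * criticalCorr 3 2 ![Pi.single 0 (2 * (m : ℤ)) + Pi.single 1 (m : ℤ), Pi.single 0 (2 * (m : ℤ)) - Pi.single 1 (m : ℤ)]) / (criticalCorr 3 2 ![0, Pi.single 0 (2 * (m : ℤ)) - Pi.single 1 (m : ℤ)] * criticalCorr 3 2 ![e₂, Pi.single 0 (2 * (m : ℤ)) + Pi.single 1 (m : ℤ)])) →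
      FarMergingShape cc2 (criticalCorr 3 4) :=
  _root_.Summit.CriticalPhenomena.Ising3DConformalLimit.EnergyNotSigmaSquaredGapForcesFarMerging.stub_scaleIteration

/-! ## Lattice bookkeeping for the glue (data-valued abbreviations, not registered) -/

/-- The far point `xR m = 2m·e₁` (GAP is applied at `x = xR m`, `‖xR m‖ = 2m`). [folklore] -/
def xR (m : ℕ) : Site 3 := Pi.single 0 (2 * (m : ℤ))

/-- Upper far target `up m = (2m, m, 0)`. [folklore] -/
def up (m : ℕ) : Site 3 := Pi.single 0 (2 * (m : ℤ)) + Pi.single 1 (m : ℤ)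

/-- Lower far target `dn m = (2m, -m, 0)`. [folklore] -/
def dn (m : ℕ) : Site 3 := Pi.single 0 (2 * (m : ℤ)) - Pi.single 1 (m : ℤ)

/-- The mirror image of `up m` through `{x₀ = m}` is `m e₂`. [folklore] -/
theorem mirror_up (m : ℕ) : up m - Pi.single 0 (2 * (up m 0 - m)) = Pi.single 1 (m : ℤ) := by
  ext i; fin_cases i <;> simp [up]; ring

/-- The mirror image of `dn m` through `{x₀ = m}` is `-m e₂`. [folklore] -/
theorem mirror_dn (m : ℕ) : dn m - Pi.single 0 (2 * (dn m 0 - m)) = Pi.single 1 (-(m : ℤ)) := by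
  ext i; fin_cases i <;> simp [dn]; ring

/-- `(up m)₀ = 2m`. [folklore] -/
theorem up_zero (m : ℕ) : up m 0 = 2 * (m : ℤ) := by simp [up]

/-- `(dn m)₀ = 2m`. [folklore] -/
theorem dn_zero (m : ℕ) : dn m 0 = 2 * (m : ℤ) := by simp [dn]

/-- `xR m ≠ 0` for `m ≥ 1`. [folklore] -/
theorem xR_ne_zero {m : ℕ} (hm : 1 ≤ m) : xR m ≠ 0 := by
  intro h
  have := congrFun h 0
  simp [xR] at this
  omega

/-- `‖xR m‖ = 2m`. [folklore] -/
theorem norm_xR (m : ℕ) : ‖xR m‖ = 2 * (m : ℝ) := by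
  rw [xR, Pi.norm_single, Int.norm_eq_abs]
  push_cast
  rw [abs_of_nonneg (by positivity)]

/-! ## Proved glue: GAP ⟹ single-pinch law (exponent `κ/2`), and the composition -/

/-- **GAP un-pinched** (proved): the isosceles instances of stub 1, the envelope (stub 2) and
`EnergyGapPowerLaw` give the single-pinch law with `κ' = κ/2`, `C' = √(2 max(C,0))`. GAP is consumed
here and only here. [folklore] -/
theorem gapGivesSinglePinch
    (hRP : ∀ (m : ℕ) (y z : Site 3), (m : ℤ) ≤ y 0 → (m : ℤ) ≤ z 0 →
      (criticalCorr 3 4 ![0, e₂, y, z] - criticalCorr 3 2 ![0, e₂] * criticalCorr 3 2 ![y, z]) ^ 2 ≤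
        (criticalCorr 3 4 ![0, e₂, Pi.single 0 (2 * (m : ℤ)), Pi.single 0 (2 * (m : ℤ)) + e₂] - criticalCorr 3 2 ![0, e₂] * criticalCorr 3 2 ![Pi.single 0 (2 * (m : ℤ)), Pi.single 0 (2 * (m : ℤ)) + e₂]) *
          (criticalCorr 3 4 ![y - Pi.single 0 (2 * (y 0 - m)), z - Pi.single 0 (2 * (z 0 - m)), y, z] - criticalCorr 3 2 ![y - Pi.single 0 (2 * (y 0 - m)), z - Pi.single 0 (2 * (z 0 - m))] * criticalCorr 3 2 ![y, z]))
    (hE : ∀ m : ℕ, 1 ≤ m →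
      0 ≤ criticalCorr 3 4 ![Pi.single 1 (m : ℤ), Pi.single 1 (-(m : ℤ)), Pi.single 0 (2 * (m : ℤ)) + Pi.single 1 (m : ℤ), Pi.single 0 (2 * (m : ℤ)) - Pi.single 1 (m : ℤ)] - criticalCorr 3 2 ![Pi.single 1 (m : ℤ), Pi.single 1 (-(m : ℤ))] * criticalCorr 3 2 ![Pi.single 0 (2 * (m : ℤ)) + Pi.single 1 (m : ℤ), Pi.single 0 (2 * (m : ℤ)) - Pi.single 1 (m : ℤ)] ∧
        criticalCorr 3 4 ![Pi.single 1 (m : ℤ), Pi.single 1 (-(m : ℤ)), Pi.single 0 (2 * (m : ℤ)) + Pi.single 1 (m : ℤ), Pi.single 0 (2 * (m : ℤ)) - Pi.single 1 (m : ℤ)] - criticalCorr 3 2 ![Pi.single 1 (m : ℤ), Pi.single 1 (-(m : ℤ))] * criticalCorr 3 2 ![Pi.single 0 (2 * (m : ℤ)) + Pi.single 1 (m : ℤ), Pi.single 0 (2 * (m : ℤ)) - Pi.single 1 (m : ℤ)] ≤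
          2 * criticalTwoPoint 3 (Pi.single 0 (2 * (m : ℤ))) ^ 2)
    (hGAP : EnergyGapPowerLaw) :
    ∃ κ' C : ℝ, 0 < κ' ∧ ∀ m : ℕ, 1 ≤ m →
        criticalCorr 3 4 ![0, e₂, Pi.single 0 (2 * (m : ℤ)) + Pi.single 1 (m : ℤ), Pi.single 0 (2 * (m : ℤ)) - Pi.single 1 (m : ℤ)] - criticalCorr 3 2 ![0, e₂] * criticalCorr 3 2 ![Pi.single 0 (2 * (m : ℤ)) + Pi.single 1 (m : ℤ), Pi.single 0 (2 * (m : ℤ)) - Pi.single 1 (m : ℤ)] ≤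
          C * (2 * (m : ℝ)) ^ (-κ') * criticalTwoPoint 3 (Pi.single 0 (2 * (m : ℤ))) ^ 2 := by
  obtain ⟨κ, C, hκ, hG⟩ := hGAP
  refine ⟨κ / 2, Real.sqrt (2 * max C 0), by positivity, fun m hm => ?_⟩
  -- GAP at `x = xR m`
  have hgap : criticalCorr 3 4 ![0, e₂, xR m, xR m + e₂] - criticalCorr 3 2 ![0, e₂] * criticalCorr 3 2 ![xR m, xR m + e₂] ≤
      max C 0 * (2 * (m : ℝ)) ^ (-κ) * criticalTwoPoint 3 (xR m) ^ 2 := by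
    have h := hG (xR m) (xR_ne_zero hm)
    rw [norm_xR] at h
    refine (le_of_eq_of_le rfl h).trans ?_
    gcongr
    exact le_max_left _ _
  -- the envelope
  obtain ⟨hE0, hE2⟩ := hE m hm
  -- the RP minor at the isosceles targets
  have hRP' := hRP m (up m) (dn m) (by rw [up_zero]; omega) (by rw [dn_zero]; omega)
  rw [mirror_up, mirror_dn] at hRP'
  change (criticalCorr 3 4 ![0, e₂, up m, dn m] - criticalCorr 3 2 ![0, e₂] * criticalCorr 3 2 ![up m, dn m]) ^ 2 ≤
      (criticalCorr 3 4 ![0, e₂, xR m, xR m + e₂] - criticalCorr 3 2 ![0, e₂] * criticalCorr 3 2 ![xR m, xR m + e₂]) *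
        (criticalCorr 3 4 ![Pi.single 1 (m : ℤ), Pi.single 1 (-(m : ℤ)), up m, dn m] -
          criticalCorr 3 2 ![Pi.single 1 (m : ℤ), Pi.single 1 (-(m : ℤ))] * criticalCorr 3 2 ![up m, dn m]) at hRP'
  change 0 ≤ criticalCorr 3 4 ![Pi.single 1 (m : ℤ), Pi.single 1 (-(m : ℤ)), up m, dn m] -
      criticalCorr 3 2 ![Pi.single 1 (m : ℤ), Pi.single 1 (-(m : ℤ))] * criticalCorr 3 2 ![up m, dn m] at hE0
  change criticalCorr 3 4 ![Pi.single 1 (m : ℤ), Pi.single 1 (-(m : ℤ)), up m, dn m] -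
      criticalCorr 3 2 ![Pi.single 1 (m : ℤ), Pi.single 1 (-(m : ℤ))] * criticalCorr 3 2 ![up m, dn m] ≤
        2 * criticalTwoPoint 3 (xR m) ^ 2 at hE2
  show criticalCorr 3 4 ![0, e₂, up m, dn m] - criticalCorr 3 2 ![0, e₂] * criticalCorr 3 2 ![up m, dn m] ≤
      Real.sqrt (2 * max C 0) * (2 * (m : ℝ)) ^ (-(κ / 2)) * criticalTwoPoint 3 (xR m) ^ 2
  set t := criticalCorr 3 4 ![0, e₂, up m, dn m] - criticalCorr 3 2 ![0, e₂] * criticalCorr 3 2 ![up m, dn m] with ht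
  set g := criticalTwoPoint 3 (xR m) with hg
  set B := Real.sqrt (2 * max C 0) * (2 * (m : ℝ)) ^ (-(κ / 2)) * g ^ 2 with hB
  have hm0 : (0 : ℝ) < 2 * (m : ℝ) := by positivity
  have hB0 : 0 ≤ B := by positivity
  have key : t ^ 2 ≤ (max C 0 * (2 * (m : ℝ)) ^ (-κ) * g ^ 2) * (2 * g ^ 2) :=
    hRP'.trans (mul_le_mul hgap hE2 hE0 (by positivity))
  have hsq : (max C 0 * (2 * (m : ℝ)) ^ (-κ) * g ^ 2) * (2 * g ^ 2) = B ^ 2 := by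
    have h2 : ((2 * (m : ℝ)) ^ (-(κ / 2))) ^ 2 = (2 * (m : ℝ)) ^ (-κ) := by
      rw [← Real.rpow_natCast ((2 * (m : ℝ)) ^ (-(κ / 2))) 2, ← Real.rpow_mul hm0.le]
      norm_num
    rw [hB, mul_pow, mul_pow, Real.sq_sqrt (by positivity), h2]
    ring
  calc t ≤ |t| := le_abs_self t
    _ = Real.sqrt (t ^ 2) := (Real.sqrt_sq_eq_abs t).symm
    _ ≤ Real.sqrt (B ^ 2) := Real.sqrt_le_sqrt (key.trans_eq hsq)
    _ = B := Real.sqrt_sq hB0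

/-- **Composition (kernel-checked; `sorry` only inside the five registered stubs): the stubs imply the
crux BY NAME.** `EnergyGapPowerLaw` (the crux's own hypothesis) is consumed once, in
`gapGivesSinglePinch` (stubs 1–2); stubs 3–5 turn the resulting single-pinch law into far merging,
which is the crux's conclusion (`Negative.crux_iff`, `Iff.rfl`). [folklore] -/
theorem GapForcesFarMerging_of :
    Summit.CriticalPhenomena.Ising3DConformalLimit.Theses.EnergyNotSigmaSquared.GapForcesFarMerging :=
  crux_iff.2 fun hGAP =>
    stub_scaleIteration (gapGivesSinglePinch stub_rpUnpinch stub_unpinchedEnvelope hGAP)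
      stub_singlePinchPositive stub_quasiMultiplicative

end Summit.CriticalPhenomena.Ising3DConformalLimit.Cruxes.GapForcesFarMerging.RpUnpinchSinglePassage

end
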